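import Mathlib
import Summits.Ventures.PercRepro2.MixChordOLeafRoot
import Summits.Ventures.PercRepro2.CutOneFarMarked
import Summits.Ventures.PercRepro2.PendantEdm

/-!
# The `o`-class chord when `a₃` is ALONE BEHIND A CUT VERTEX at a root or at `o`
(blind cell PercRepro2, night-1 g22; proofs/NIGHT1-G22.md §4)

typer-1 g48's one-far-mark equivalence (`CutOneFar.Gc_eq_reduced`): with `v` a cut vertex, the mark
`a₃` alone on the left side `L` and `o, a₁, a₂, b` on the right side (or at `v`), the covariance form
of `G` is that of the reduced graph — the right edges plus ONE pendant edge `{v, a₃}` of weight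
`r = P(a₃ ↔ v by left edges)` — through the configuration map `Ψ` (`prob_Ψ_preimage`).  The `o`-edge
`f = {o, a₁}` is a right edge, the left probability `r` does not see it (`leftProb_update`), and the
reduced weights of `p[f ↦ c]` are the pinned reduced weights (`rweights_update`); with the
`PD`-masses transported as well (`prob_PD_reduced`) the mixed chord with normaliser `D` transports:
**`nMixChord_normD_reduced`**.  Hence the three leaf classes of MixChordOLeafRoot.lean lift to
cut-vertex classes (the `D`-chord, and the chain's `(D·Z)²`-chord unconditionally by typer-1's
`HCov_a3_behind_*`):
**`dChord_o_edge_a3_behind_a2`**, **`dChord_o_edge_a3_behind_a1`**, **`dChord_o_edge_a3_behind_o`**,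
**`dz2Chord_o_edge_a3_behind_a2`**, **`dz2Chord_o_edge_a3_behind_a1`**, **`dz2Chord_o_edge_a3_behind_o`**
— the `o`-class row of the chain of record holds along `{o, a₁}` whenever `a₃`'s whole side of a cut
vertex `v ∈ {a₁, a₂, o}` carries no other mark (any graph on that side, any weights).
Own code; standard axioms.
-/

namespace Summit.Ventures.PercRepro2

open UnionCluster CovForm CutVertexM9 CutOneFar

namespace Mix

section Transport

variable {V : Type*} {E : Type*} [Fintype E] [DecidableEq E] {R : Type*} [Field R]
  [LinearOrder R] [IsStrictOrderedRing R]

variable {ends : E → Sym2 V} {side : E → Bool} {L : Set V} {v : V} {Rt : Set V} {w : V}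

omit [Fintype E] [DecidableEq E] [LinearOrder R] [IsStrictOrderedRing R] in
/-- The left connection event is free of every right edge. -/
lemma free_leftConn (ends : E → Sym2 V) (side : E → Bool) (v w : V) {f : E} (hf : side f = false) :
    PendantRoot.Free f {ω : Config E | Conn ends (CutVertexM9.restrict side true ω) w v} := by
  unfold PendantRoot.Free
  refine DependsOn.mono (s := {e | side e = true}) ?_ ?_
  · intro e he hef
    have : e = f := Set.mem_singleton_iff.1 (by simpa using hef)
    rw [this] at he
    simp [hf] at he
  · intro ω ω' h
    simp only [Set.mem_setOf_eq]
    rw [restrict_eq_of_agree (b := true) h]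

omit [LinearOrder R] [IsStrictOrderedRing R] in
/-- The left probability does not see a right edge. -/
lemma leftProb_update (ends : E → Sym2 V) (side : E → Bool) (v w : V) (p : E → R) {f : E}
    (hf : side f = false) (c : R) :
    leftProb ends side v w (Function.update p f c) = leftProb ends side v w p := by
  unfold leftProb
  exact PendantEdm.prob_update_of_free p (free_leftConn ends side v w hf) c

omit [Fintype E] [Field R] [LinearOrder R] [IsStrictOrderedRing R] in
/-- Pinning a right edge commutes with the reduction. -/
lemma rweights_update (side : E → Bool) (p : E → R) (r : R) {f : E} (hf : side f = false) (c : R) :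
    rweights side (Function.update p f c) r =
      Function.update (rweights side p r) (Sum.inl ⟨f, hf⟩) c := by
  funext e
  rcases e with e | e
  · by_cases h : e.1 = f
    · have he : e = ⟨f, hf⟩ := Subtype.ext h
      subst he
      simp [rweights]
    · have he : (Sum.inl e : REdge side) ≠ Sum.inl ⟨f, hf⟩ := by
        intro h'
        exact h (congrArg Subtype.val (Sum.inl.inj h'))
      rw [Function.update_of_ne he]
      simp [rweights, Function.update_of_ne h]
  · simp [rweights]

omit [LinearOrder R] [IsStrictOrderedRing R] in
/-- The `PD`-mass transports to the reduced graph. -/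
lemma prob_PD_reduced (h : CutVertex ends side L v Rt) (hw : w ∈ L) (p : E → R) {a₁ a₂ a₃ : V}
    (h1 : a₁ = w ∨ a₁ ∈ Rt ∨ a₁ = v) (h2 : a₂ = w ∨ a₂ ∈ Rt ∨ a₂ = v)
    (h3 : a₃ = w ∨ a₃ ∈ Rt ∨ a₃ = v) :
    prob p (PDEvent ends a₁ a₂ a₃) =
      prob (rweights side p (leftProb ends side v w p)) (PDEvent (rends ends side v w) a₁ a₂ a₃) := by
  rw [← prob_Ψ_preimage ends side v w p]
  congr 1
  exact (preimage_PDEvent_of_mem' (M := {x | x = w ∨ x ∈ Rt ∨ x = v})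
    (fun ω x hx z hz => conn_marks_iff h hw ω hx hz) h1 h2 h3).symm

omit [IsStrictOrderedRing R] in
/-- **The `D`-chord transports through the one-far-mark reduction** (the `o`-edge `f` a right edge). -/
theorem nMixChord_normD_reduced (h : CutVertex ends side L v Rt) (hw : w ∈ L) (p : E → R)
    {o a₁ a₂ a₃ b : V} (hM : ∀ m ∈ ({o, a₁, a₂, a₃, b} : Set V), m = w ∨ m ∈ Rt ∨ m = v)
    {f : E} (hf : side f = false) :
    NMixChord (normD ends a₁ a₂ a₃) p ends o a₁ a₂ a₃ b f ↔
      NMixChord (normD (rends ends side v w) a₁ a₂ a₃) (rweights side p (leftProb ends side v w p))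
        (rends ends side v w) o a₁ a₂ a₃ b (Sum.inl ⟨f, hf⟩) := by
  have h1 : a₁ ∈ ({o, a₁, a₂, a₃, b} : Set V) := by simp
  have h2 : a₂ ∈ ({o, a₁, a₂, a₃, b} : Set V) := by simp
  have h3 : a₃ ∈ ({o, a₁, a₂, a₃, b} : Set V) := by simp
  unfold NMixChord normD
  rw [Gc_eq_reduced h hw p o a₁ a₂ a₃ b hM,
    Gc_eq_reduced h hw (Function.update p f 0) o a₁ a₂ a₃ b hM,
    Gc_eq_reduced h hw (Function.update p f 1) o a₁ a₂ a₃ b hM,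
    prob_PD_reduced h hw p (hM a₁ h1) (hM a₂ h2) (hM a₃ h3),
    prob_PD_reduced h hw (Function.update p f 0) (hM a₁ h1) (hM a₂ h2) (hM a₃ h3),
    leftProb_update ends side v w p hf, leftProb_update ends side v w p hf]
  rw [rweights_update side p (leftProb ends side v w p) hf 0,
    rweights_update side p (leftProb ends side v w p) hf 1]
  exact Iff.rfl

end Transport

section Classes

variable {V : Type*} {E : Type*} [Fintype E] [DecidableEq E] [Fintype V] [DecidableEq V]
  {R : Type*} [Field R] [LinearOrder R] [IsStrictOrderedRing R]

variable {ends : E → Sym2 V} {side : E → Bool} {L : Set V} {v : V} {Rt : Set V}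

omit [Fintype E] [DecidableEq E] [Fintype V] [DecidableEq V] in
/-- An edge between two right-side marks (or the cut vertex) is a right edge. -/
lemma side_eq_false_of_right (h : CutVertex ends side L v Rt) {f : E} {x y : V}
    (hf : ends f = s(x, y)) (hx : x ∈ Rt ∨ x = v) (hy : y ∈ Rt ∨ y = v) (hxy : x ≠ y) :
    side f = false := by
  by_contra hs
  have hs' : side f = true := by simpa using hs
  have hx' := h.left f hs' x (by rw [hf]; exact Sym2.mem_mk_left x y)
  have hy' := h.left f hs' y (by rw [hf]; exact Sym2.mem_mk_right x y)
  have ex : x = v := by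
    rcases hx' with hxL | hxv
    · rcases hx with hxR | hxv
      · exact (h.disj x hxL hxR).elim
      · exact hxv
    · exact hxv
  have ey : y = v := by
    rcases hy' with hyL | hyv
    · rcases hy with hyR | hyv
      · exact (h.disj y hyL hyR).elim
      · exact hyv
    · exact hyv
  exact hxy (ex.trans ey.symm)

omit [Fintype E] [DecidableEq E] [Fintype V] [DecidableEq V] in
/-- The marks of an instance with `a₃` behind `v` and the rest on the right. -/
lemma marks_right {o a₁ a₂ a₃ b : V} (hw : a₃ ∈ L) (ho : o ∈ Rt ∨ o = v) (h1 : a₁ ∈ Rt ∨ a₁ = v)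
    (h2 : a₂ ∈ Rt ∨ a₂ = v) (hb : b ∈ Rt ∨ b = v) :
    ∀ m ∈ ({o, a₁, a₂, a₃, b} : Set V), m = a₃ ∨ m ∈ Rt ∨ m = v := by
  intro m hm
  simp only [Set.mem_insert_iff, Set.mem_singleton_iff] at hm
  rcases hm with rfl | rfl | rfl | rfl | rfl
  · exact Or.inr ho
  · exact Or.inr h1
  · exact Or.inr h2
  · exact Or.inl rfl
  · exact Or.inr hb

/-- **`a₃` alone behind the cut vertex `a₂`: the `o`-class `D`-chord along `{o, a₁}`.** -/
theorem dChord_o_edge_a3_behind_a2 (h : CutVertex ends side L v Rt) {p : E → R} (hp : IsProbVec p)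
    {o a₁ a₃ b : V} (hw : a₃ ∈ L) (ho : o ∈ Rt ∨ o = v) (h1 : a₁ ∈ Rt ∨ a₁ = v)
    (hb : b ∈ Rt ∨ b = v) {f : E} (hf : ends f = s(o, a₁)) (ho1 : o ≠ a₁) :
    NMixChord (normD ends a₁ v a₃) p ends o a₁ v a₃ b f := by
  have hs := side_eq_false_of_right h hf ho h1 ho1
  rw [nMixChord_normD_reduced h hw p (marks_right hw ho h1 (Or.inr rfl) hb) hs]
  exact dChord_o_edge_of_leaf_root₂ _ _ b (isProbVec_rweights_leftProb ends side v a₃ hp)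
    (show rends ends side v a₃ (Sum.inl ⟨f, hs⟩) = s(o, a₁) from hf)
    (rends_pendant ends side v a₃) (leaf_reduced h hw) (far_ne_cut h hw)
    (far_ne_right h hw h1) (far_ne_right h hw ho).symm (far_ne_right h hw hb).symm

/-- **`a₃` alone behind the cut vertex `a₁`: the `o`-class `D`-chord along `{o, a₁}`.** -/
theorem dChord_o_edge_a3_behind_a1 (h : CutVertex ends side L v Rt) {p : E → R} (hp : IsProbVec p)
    {o a₂ a₃ b : V} (hw : a₃ ∈ L) (ho : o ∈ Rt ∨ o = v) (h2 : a₂ ∈ Rt ∨ a₂ = v)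
    (hb : b ∈ Rt ∨ b = v) {f : E} (hf : ends f = s(o, v)) (ho1 : o ≠ v) :
    NMixChord (normD ends v a₂ a₃) p ends o v a₂ a₃ b f := by
  have hs := side_eq_false_of_right h hf ho (Or.inr rfl) ho1
  rw [nMixChord_normD_reduced h hw p (marks_right hw ho (Or.inr rfl) h2 hb) hs]
  exact dChord_o_edge_of_leaf_root₁ _ _ b (isProbVec_rweights_leftProb ends side v a₃ hp)
    (show rends ends side v a₃ (Sum.inl ⟨f, hs⟩) = s(o, v) from hf)
    (rends_pendant ends side v a₃) (leaf_reduced h hw) (far_ne_right h hw h2) (far_ne_cut h hw)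
    (far_ne_right h hw ho).symm (far_ne_right h hw hb).symm

/-- **`a₃` alone behind the cut vertex `o`: the `o`-class `D`-chord along `{o, a₁}`.** -/
theorem dChord_o_edge_a3_behind_o (h : CutVertex ends side L v Rt) {p : E → R} (hp : IsProbVec p)
    {a₁ a₂ a₃ b : V} (hw : a₃ ∈ L) (h1 : a₁ ∈ Rt ∨ a₁ = v) (h2 : a₂ ∈ Rt ∨ a₂ = v)
    (hb : b ∈ Rt ∨ b = v) {f : E} (hf : ends f = s(v, a₁)) (ho1 : v ≠ a₁) :
    NMixChord (normD ends a₁ a₂ a₃) p ends v a₁ a₂ a₃ b f := by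
  have hs := side_eq_false_of_right h hf (Or.inr rfl) h1 ho1
  rw [nMixChord_normD_reduced h hw p (marks_right hw (Or.inr rfl) h1 h2 hb) hs]
  exact dChord_o_edge_of_leaf_o _ _ b (isProbVec_rweights_leftProb ends side v a₃ hp)
    (show rends ends side v a₃ (Sum.inl ⟨f, hs⟩) = s(v, a₁) from hf)
    (rends_pendant ends side v a₃) (leaf_reduced h hw) (far_ne_cut h hw)
    (far_ne_right h hw h1) (far_ne_right h hw h2) (far_ne_right h hw hb).symm

/-- **The chain's row (`(D·Z)²`-chord) along `{o, a₁}`, `a₃` alone behind the cut vertex `a₂`.** -/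
theorem dz2Chord_o_edge_a3_behind_a2 (h : CutVertex ends side L v Rt) {p : E → R} (hp : IsProbVec p)
    {o a₁ a₃ b : V} (hw : a₃ ∈ L) (ho : o ∈ Rt ∨ o = v) (h1 : a₁ ∈ Rt ∨ a₁ = v)
    (hb : b ∈ Rt ∨ b = v) {f : E} (hf : ends f = s(o, a₁)) (ho1 : o ≠ a₁) :
    NMixChord (normDZ2 ends a₁ v a₃) p ends o a₁ v a₃ b f :=
  nMixChord_DZ2_of_D hp (dChord_o_edge_a3_behind_a2 h hp hw ho h1 hb hf ho1)
    (HCov_a3_behind_a2 h (hp.update f le_rfl zero_le_one) hw ho h1 hb)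

/-- **The chain's row along `{o, a₁}`, `a₃` alone behind the cut vertex `a₁`.** -/
theorem dz2Chord_o_edge_a3_behind_a1 (h : CutVertex ends side L v Rt) {p : E → R} (hp : IsProbVec p)
    {o a₂ a₃ b : V} (hw : a₃ ∈ L) (ho : o ∈ Rt ∨ o = v) (h2 : a₂ ∈ Rt ∨ a₂ = v)
    (hb : b ∈ Rt ∨ b = v) {f : E} (hf : ends f = s(o, v)) (ho1 : o ≠ v) :
    NMixChord (normDZ2 ends v a₂ a₃) p ends o v a₂ a₃ b f :=
  nMixChord_DZ2_of_D hp (dChord_o_edge_a3_behind_a1 h hp hw ho h2 hb hf ho1)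
    (HCov_a3_behind_a1 h (hp.update f le_rfl zero_le_one) hw ho h2 hb)

/-- **The chain's row along `{o, a₁}`, `a₃` alone behind the cut vertex `o`.** -/
theorem dz2Chord_o_edge_a3_behind_o (h : CutVertex ends side L v Rt) {p : E → R} (hp : IsProbVec p)
    {a₁ a₂ a₃ b : V} (hw : a₃ ∈ L) (h1 : a₁ ∈ Rt ∨ a₁ = v) (h2 : a₂ ∈ Rt ∨ a₂ = v)
    (hb : b ∈ Rt ∨ b = v) {f : E} (hf : ends f = s(v, a₁)) (ho1 : v ≠ a₁) :
    NMixChord (normDZ2 ends a₁ a₂ a₃) p ends v a₁ a₂ a₃ b f :=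
  nMixChord_DZ2_of_D hp (dChord_o_edge_a3_behind_o h hp hw h1 h2 hb hf ho1)
    (HCov_a3_behind_o h (hp.update f le_rfl zero_le_one) hw h1 h2 hb)

end Classes

end Mix

end Summit.Ventures.PercRepro2
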